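import Summits.CriticalPhenomena.PercolationContinuityZ3.Theorems.Transplant.Slab111HubXPlanOf
import Summits.CriticalPhenomena.PercolationContinuityZ3.Theorems.Transplant.Slab111HubXRules
import Summits.CriticalPhenomena.PercolationContinuityZ3.Theorems.Transplant.Slab111HubXFast
import HarnessLib

/-!
# The HUB ROUTING of the `(111)`-films, XXXII-X: coded CERTIFICATES of the zone-free dispatcher and their soundness (`certOK_swap`)

builds on p205010 (kernel theorem, internal audit signed; external expert review pending) — NOT used in this file.  Lane `prim-bschramm`, seat
`prim-bschramm-p2` (gen 37; class C1b; memo `HOME/bschramm/P2-LATTICES.md` §135); helper file (`--supports stmt-CriticalPhenomena-4575 --as helper`).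
A key `(q₁, q₂, q₃)` (terminal columns relative to the block centre) of a shape is certified by a list of numerals (`250`-bit chunks of a base-`32` digit stream, `XCode.digits`) selecting
entries («Slab111HubXAcc».`EntryX`) from the row's POOL (itself such a stream) and encoding a decision tree («Slab111HubXTree».`Tree`, children given by cut points) — §1 the decoder (no correctness claim is needed:
whatever it decodes is checked).  §2 **`certOK`**: the tree checks on the full box against the decoded entries and the rules of the key
(«Slab111HubXRules»), with the fast checker of «Slab111HubXFast», for thickness `k ≥ kmin`; **`certOK_swap`**: then every certified terminal triple over these columns, in a film of thickness
`k ≥ kmin`, has a swap pair.  §3 rows: `certRowOK` checks the certificates of all `w'`-columns for fixed `(q₁, q₂)`.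
[cite: DuminilCopinSidoraviciusTassion2016, §2.3 (proof of Fact 2: the three disjoint paths γ_u, γ_v, γ_w in B_R(z))]
-/

noncomputable section

namespace Summit.CriticalPhenomena.PercolationContinuityZ3.Theorems.Transplant

open Literature.Probability.Percolation Literature.Probability.LatticeModels SimpleGraph
open scoped Classical

namespace Slab111

variable {k : ℕ}

/-! ## §1 Decoding -/

namespace XCode

/-- Digit base (`5` bits per digit). [folklore] -/
def base : ℕ := 32

/-- Digits per written chunk (a chunk is a numeral `< 32 ^ 50 = 2 ^ 250`). [folklore] -/
def chunkLen : ℕ := 50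

/-- The `n` low digits of a chunk, least significant first. [folklore] -/
def chunkDigits : ℕ → ℕ → List ℕ
  | 0, _ => []
  | n + 1, c => (c % base) :: chunkDigits n (c / base)

/-- **The digit stream of a certificate** written as a list of chunks. [folklore] -/
def digits (cs : List ℕ) : List ℕ := cs.flatMap (chunkDigits chunkLen)

/-- Read one digit (`0` past the end). [folklore] -/
def rd : List ℕ → ℕ × List ℕ
  | [] => (0, [])
  | d :: ds => (d, ds)

/-- A column from its two-digit code `(x+8)·17 + (y+8)`. [folklore] -/
def col (D : List ℕ) : (ℤ × ℤ) × List ℕ :=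
  let (a, D) := rd D
  let (b, D) := rd D
  let d := a + base * b
  ((((d / 17 : ℕ) : ℤ) - 8, ((d % 17 : ℕ) : ℤ) - 8), D)

/-- A signed small integer from its one-digit code `v + 16`. [folklore] -/
def sg (d : ℕ) : ℤ := (d : ℤ) - 16

/-- A two-digit index. [folklore] -/
def idx (D : List ℕ) : ℕ × List ℕ :=
  let (a, D) := rd D
  let (b, D) := rd D
  (a + base * b, D)

/-- Read a face: three columns. [folklore] -/
def face (D : List ℕ) : FaceD × List ℕ :=
  let (f0, D) := col D
  let (f1, D) := col D
  let (f2, D) := col D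
  (⟨f0, f1, f2⟩, D)

/-- Read `n` leg vertices. [folklore] -/
def legGo : ℕ → List ℕ → List MV → List MV × List ℕ
  | 0, D, acc => (acc.reverse, D)
  | n + 1, D, acc =>
    let (c, D) := col D
    let (l, D) := rd D
    legGo n D ((c, sg l) :: acc)

/-- Read a leg: a length digit then (column, level) pairs. [folklore] -/
def leg (D : List ℕ) : List MV × List ℕ :=
  let (n, D) := rd D
  legGo n D []

/-- Read an entry. [folklore] -/
def entry (D : List ℕ) : EntryX × List ℕ :=
  let (F1, D) := face D
  let (d1, D) := rd D
  let (F2, D) := face D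
  let (d2, D) := rd D
  let (F3, D) := face D
  let (d3, D) := rd D
  let (t, D) := rd D
  let (a, D) := rd D
  let (l₁, D) := leg D
  let (l₂, D) := leg D
  let (l₃, D) := leg D
  (⟨F1, F2, F3, sg d1, sg d2, sg d3, sg t, sg a, l₁, l₂, l₃⟩, D)

/-- Read `m` entries. [folklore] -/
def entries : ℕ → List ℕ → List EntryX → List EntryX × List ℕ
  | 0, D, acc => (acc.reverse, D)
  | m + 1, D, acc => let (e, D') := entry D; entries m D' (e :: acc)

mutual
/-- Read a tree (fuel-bounded) inside the box `(blo, bhi)` of its coordinate intervals: tag `0` entry (one-digit index), `4` entry (two-digit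
index), `1` excluded (one digit), `2` empty, `3` node — coordinate, number of children `m`, the `m − 1` CUT points (upper ends of all children but
the last; the children tile the current interval), then the `m` subtrees. [folklore] -/
def tree : ℕ → List ℕ → List ℤ → List ℤ → Tree × List ℕ
  | 0, D, _, _ => (.emp, D)
  | fuel + 1, D, blo, bhi =>
    let (tag, D) := rd D
    if tag = 0 then let (i, D) := rd D; (.ent i, D)
    else if tag = 4 then let (i, D) := idx D; (.ent i, D)
    else if tag = 1 then let (j, D) := rd D; (.excl j, D)
    else if tag = 2 then (.emp, D)
    else
      let (c, D) := rd D
      let (m, D) := rd D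
      let (ks, D) := kids fuel m c (blo.getD c 0 - 1) (bhi.getD c 0) D blo bhi
      (.node c ks, D)
/-- Read `m` children of a split of coordinate `c`: the previous upper end `prev`, the final upper end `top`. [folklore] -/
def kids : ℕ → ℕ → ℕ → ℤ → ℤ → List ℕ → List ℤ → List ℤ → List (ℤ × ℤ × Tree) × List ℕ
  | 0, _, _, _, _, D, _, _ => ([], D)
  | _ + 1, 0, _, _, _, D, _, _ => ([], D)
  | fuel + 1, m + 1, c, prev, top, D, blo, bhi =>
    let (cut, D) := (if m = 0 then (top, D) else let (h, D) := rd D; (sg h, D))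
    let (t, D) := tree fuel D (blo.set c (prev + 1)) (bhi.set c cut)
    let (rest, D) := kids fuel m c cut top D blo bhi
    ((prev + 1, cut, t) :: rest, D)
end

/-- **Decode the entry pool of a row** (two-digit count, then the entries). [folklore] -/
def pool (cs : List ℕ) : List EntryX :=
  let D := digits cs
  let (m, D) := idx D
  (entries m D []).1

/-- Read `m` pool indices (two digits each) and select the entries. [folklore] -/
def select (es : List EntryX) : ℕ → List ℕ → List EntryX → List EntryX × List ℕ
  | 0, D, acc => (acc.reverse, D)
  | m + 1, D, acc => let (i, D') := idx D; select es m D' ((es.getD i ⟨⟨(0,0),(0,0),(0,0)⟩, ⟨(0,0),(0,0),(0,0)⟩, ⟨(0,0),(0,0),(0,0)⟩, 0, 0, 0, 0, 0, [], [], []⟩) :: acc)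

/-- **Decode a key certificate** against the row's pool: the selected entries (two-digit count and indices) and the tree (read in the full box). [folklore] -/
def cert (es : List EntryX) (cs : List ℕ) : List EntryX × Tree :=
  let D := digits cs
  let (m, D) := idx D
  let (sel, D) := select es m D []
  (sel, (tree 4096 D patFullBox.lo patFullBox.hi).1)

end XCode

/-! ## §2 The certificate checker and its soundness -/

/-- The class difference of two relative columns. [folklore] -/
def lamDiff (q q' : ℤ × ℤ) : ℤ := (q'.1 + 2 * q'.2) - (q.1 + 2 * q.2)

/-- **The certificate check of a key** against a pool of entries. [folklore] -/
def certOK (S : ShapeB) (kmin : ℤ) (q₁ q₂ q₃ : ℤ × ℤ) (es : List EntryX) (cs : List ℕ) : Bool :=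
  let (sel, t) := XCode.cert es cs
  let ents := sel.map fun e => (e.staticB S q₁ q₂ q₃, e.fm S q₁ q₂ q₃)
  (ents.all fun sf => sf.2.ws) &&
    treeOK2 ents (rulesFm S q₁ q₂ q₃) kmin (lamDiff q₁ q₂) (lamDiff q₁ q₃) 64 patFullBox t

/-- **A CERTIFIED KEY HAS SWAP PAIRS**: at a block of a valid shape in a film of thickness `k ≥ kmin`, every certified terminal triple over the
columns `(q₁, q₂, q₃)` admits a swap pair. [cite: DuminilCopinSidoraviciusTassion2016, §2.3 (proof of Fact 2: γ_u, γ_v, γ_w)] -/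
theorem certOK_swap {S : ShapeB} {kmin : ℤ} {q₁ q₂ q₃ : ℤ × ℤ} {es : List EntryX} {cs : List ℕ} (hc : certOK S kmin q₁ q₂ q₃ es cs = true) {tR tD sR sD : ℕ}
    (hV : S.Valid tR tD sR sD) (hk : kmin ≤ (k : ℤ)) (z : Site 2) {E₁ E₂ w' : slab111 k}
    (hT : (hexShadow k).Terminals 3 z tR tD sR (WOf S k z) E₁ E₂ w') (hq1 : relC z E₁ = q₁) (hq2 : relC z E₂ = q₂) (hq3 : relC z w' = q₃) :
    ∃ r₁ r₂ : VRouteData (film k) (WOf S k z ∩ (hexShadow k).lift (blkR 3 z tR sR)) (WOf S k z) E₁ E₂ w', r₁.y = r₂.b ∧ r₁.b = r₂.y := by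
  subst hq1 hq2 hq3
  unfold certOK at hc
  have b1 := mem_slab111_iff_lev.1 E₁.2
  have b2 := mem_slab111_iff_lev.1 E₂.2
  have b3 := mem_slab111_iff_lev.1 w'.2
  have hz : (3 : ℤ) ∣ z 0 + 2 * z 1 - (z 0 + 2 * z 1) := dvd_cls_self z
  have c1 := cls_of_sh_lev hz (E := E₁) (q := relC z E₁) (n := lev (E₁ : Site 3)) ⟨sh_eq_vcol_relC z E₁, rfl⟩
  have c2 := cls_of_sh_lev hz (E := E₂) (q := relC z E₂) (n := lev (E₂ : Site 3)) ⟨sh_eq_vcol_relC z E₂, rfl⟩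
  have c3 := cls_of_sh_lev hz (E := w') (q := relC z w') (n := lev (w' : Site 3)) ⟨sh_eq_vcol_relC z w', rfl⟩
  have hc12 : (3 : ℤ) ∣ (lev (E₂ : Site 3) - lev (E₁ : Site 3)) - lamDiff (relC z E₁) (relC z E₂) := by
    unfold lamDiff
    have := dvd_sub c2 c1
    have e : lev (E₂ : Site 3) - (z 0 + 2 * z 1) - ((relC z E₂).1 + 2 * (relC z E₂).2) - (lev (E₁ : Site 3) - (z 0 + 2 * z 1) - ((relC z E₁).1 + 2 * (relC z E₁).2)) =
        lev (E₂ : Site 3) - lev (E₁ : Site 3) - ((relC z E₂).1 + 2 * (relC z E₂).2 - ((relC z E₁).1 + 2 * (relC z E₁).2)) := by ring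
    rwa [e] at this
  have hc13 : (3 : ℤ) ∣ (lev (w' : Site 3) - lev (E₁ : Site 3)) - lamDiff (relC z E₁) (relC z w') := by
    unfold lamDiff
    have := dvd_sub c3 c1
    have e : lev (w' : Site 3) - (z 0 + 2 * z 1) - ((relC z w').1 + 2 * (relC z w').2) - (lev (E₁ : Site 3) - (z 0 + 2 * z 1) - ((relC z E₁).1 + 2 * (relC z E₁).2)) =
        lev (w' : Site 3) - lev (E₁ : Site 3) - ((relC z w').1 + 2 * (relC z w').2 - ((relC z E₁).1 + 2 * (relC z E₁).2)) := by ring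
    rwa [e] at this
  have hrules := rulesFm_sound hV hT
  simp only [Bool.and_eq_true] at hc
  obtain ⟨hws, hc⟩ := hc
  rw [List.all_eq_true] at hws
  obtain ⟨sf, hsf, hst, hev⟩ := treeOK2_sound hws b1 b2 b3 hk hc12 hc13 hrules 64 patFullBox _ (by simp [patFullBox]) hc (mem_patFullBox b1 b2 b3)
  rw [List.mem_map] at hsf
  obtain ⟨e, -, rfl⟩ := hsf
  exact EntryX.swap_of_acc hV e z hT (by unfold EntryX.acc; rw [Bool.and_eq_true]; exact ⟨hst, hev⟩)

/-! ## §3 Rows -/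

/-- The `w'`-columns of a row: cleared, not the centre, not `q₁`, not `q₂`. [folklore] -/
def wcolsOf (S : ShapeB) (q₁ q₂ : ℤ × ℤ) : List (ℤ × ℤ) := S.cols.filter fun q => decide (q ≠ (0, 0) ∧ q ≠ q₁ ∧ q ≠ q₂)

/-- **The row check**: the pool of entries and one certificate per `w'`-column. [folklore] -/
def certRowOK (S : ShapeB) (kmin : ℤ) (q₁ q₂ : ℤ × ℤ) (pool : List ℕ) (Ns : List (List ℕ)) : Bool :=
  let es := XCode.pool pool
  ((wcolsOf S q₁ q₂).length == Ns.length) && ((wcolsOf S q₁ q₂).zip Ns).all fun qN => certOK S kmin q₁ q₂ qN.1 es qN.2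

/-- Soundness of the row check: every `w'`-column of the row is certified. [folklore] -/
theorem certRowOK_sound {S : ShapeB} {kmin : ℤ} {q₁ q₂ : ℤ × ℤ} {pool : List ℕ} {Ns : List (List ℕ)} (h : certRowOK S kmin q₁ q₂ pool Ns = true) :
    ∀ q₃ ∈ wcolsOf S q₁ q₂, ∃ es N, certOK S kmin q₁ q₂ q₃ es N = true := by
  unfold certRowOK at h
  rw [Bool.and_eq_true, beq_iff_eq, List.all_eq_true] at h
  obtain ⟨hlen, hall⟩ := h
  intro q₃ hq
  obtain ⟨i, hi, rfl⟩ := List.getElem_of_mem hq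
  refine ⟨_, Ns[i]'(by omega), hall ((wcolsOf S q₁ q₂)[i], Ns[i]'(by omega)) ?_⟩
  exact List.mem_iff_getElem.2 ⟨i, by simp [hlen]; omega, by simp⟩

end Slab111

end Summit.CriticalPhenomena.PercolationContinuityZ3.Theorems.Transplant

end
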